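import Literature.Geometry.Riemannian.HamiltonODEPositiveCone
import HarnessLib

/-!
# The matrix algebra in Hamilton's estimate for `a - 2b + c` (Hamilton 1986, Lemma 6.2)
(topic `Geometry/Riemannian`)

A step of the decomposition of the named fact
`Literature.Geometry.Riemannian.hamilton_positiveCurvatureOperator_classification_four`
(`HamiltonPCOClassification.lean`; Hamilton 1986, Thm. 1.1), towards Thm. 7.1 (the pinching set):
the proof of **Lemma 6.2** (J. Differential Geom. 24 (1986), pp. 168–170:
`d/dt (a - 2b + c) ≥ (a₁ + 2b₁ + c₁)(a - 2b + c)`) consists, after Danskin's formula, of the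
following finite-dimensional algebra (p. 169), all of which is PROVED here for `3 × 3` real
matrices, with `X^#` Hamilton's adjoint (`Matrix.sharp`) and `β(X, Y) = (X + Y)^# - X^# - Y^#`
the polarisation of `HamiltonODEPositiveCone.lean` (twice Hamilton's `P # Q`):

* `four_smul_sharp_combination` — "`2(A^# - 2B^# + C^#) = (A - C)^# + (A + 2B + C) # (A - 2B + C)`",
  i.e. `4(A^# - 2B^# + C^#) = 2(A - C)^# + β(A + 2B + C, A - 2B + C)`;
* `trace_sharp_of_trace_eq_zero` — "`(tr P)² = tr P² + 2 tr P^#` … if `tr P = 0` then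
  `tr P^# = -½ tr P²`" (the first identity is `trace_mul_self_add_two_trace_sharp` of
  `PinchingEstimatesConstraints.lean`);
* `parallelogram_trace` — "`tr(A - B)² + tr(C - B)² - ½ tr(A - C)² = ½ tr(A - 2B + C)²`";
  `trace_mul_self_nonneg_of_isSymm` — "the trace of the square of a symmetric matrix is the sum
  of the squares of its entries", hence `≥ 0`;
* `trace_polarSharp` — `tr β(P, Q) = tr P · tr Q - tr (PQ)`;
* `trace_mul_nonneg_of_nonneg` — `tr (XQ) ≥ 0` for symmetric `X, Q ≥ 0` (Gram factorisation);
* `trace_polarSharp_ge` — "If `P` and `Q` are two symmetric `3 × 3` matrices with `P, Q ≥ 0`,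
  and `p₁` is the smallest eigenvalue of `P` while `q` is the trace of `Q`, then
  `tr P # Q ≥ p₁ q`", variationally: if `ᵗu P u ≥ p₁ |u|²` for all `u` then
  `tr β(P, Q) ≥ 2 p₁ tr Q`.

No definitions and no named facts are introduced.

## References

* R. S. Hamilton, *Four-manifolds with positive curvature operator*, J. Differential Geom. 24
  (1986) 153–179, §6, Lemma 6.2 and its proof (pp. 168–170); §2, p. 157 (`M^#`); §6, p. 166
  (`tr A² + 2 tr A^# = (tr A)²`). [Hamilton1986]
-/

noncomputable section

open Matrix
open scoped Matrix BigOperators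

namespace Literature.Geometry.Riemannian

namespace HamiltonODE

/-! ### Polynomial identities -/

/-- **`2(A^# - 2B^# + C^#) = (A - C)^# + (A + 2B + C) # (A - 2B + C)`** (Hamilton 1986, p. 169),
in the normalisation `β = 2 #`: `4(A^# - 2B^# + C^#) = 2(A - C)^# + β(A + 2B + C, A - 2B + C)`.
[cite: Hamilton1986, §6, Lemma 6.2 (proof, p. 169)] -/
theorem four_smul_sharp_combination (A B C : Matrix (Fin 3) (Fin 3) ℝ) :
    (4 : ℝ) • (A.sharp - (2 : ℝ) • B.sharp + C.sharp) =
      (2 : ℝ) • (A - C).sharp + polarSharp (A + (2 : ℝ) • B + C) (A - (2 : ℝ) • B + C) := by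
  ext i j
  fin_cases i <;> fin_cases j <;>
    simp [polarSharp, Matrix.sharp, Matrix.adjugate_fin_three] <;> ring

/-- **`tr β(P, Q) = tr P · tr Q - tr (PQ)`**: the polarisation of `tr X^# = ½((tr X)² - tr X²)`.
[folklore] -/
theorem trace_polarSharp (P Q : Matrix (Fin 3) (Fin 3) ℝ) :
    (polarSharp P Q).trace = P.trace * Q.trace - (P * Q).trace := by
  simp only [polarSharp, Matrix.trace_fin_three, Matrix.sub_apply, Matrix.add_apply,
    Matrix.mul_apply, Fin.sum_univ_three, Matrix.sharp, Matrix.transpose_apply,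
    Matrix.adjugate_fin_three]
  simp
  ring

/-- **If `tr P = 0` then `tr P^# = -½ tr P²`** (Hamilton 1986, p. 169, from
`(tr P)² = tr P² + 2 tr P^#`). [cite: Hamilton1986, §6, Lemma 6.2 (proof, p. 169)] -/
theorem trace_sharp_of_trace_eq_zero {P : Matrix (Fin 3) (Fin 3) ℝ} (h : P.trace = 0) :
    P.sharp.trace = -(1 / 2) * (P * P).trace := by
  have := trace_mul_self_add_two_trace_sharp P
  rw [h] at this
  linarith

/-- **The parallelogram law for traces** (Hamilton 1986, p. 169):
`tr(A - B)² + tr(C - B)² - ½ tr(A - C)² = ½ tr(A - 2B + C)²`, for arbitrary square matrices.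
[cite: Hamilton1986, §6, Lemma 6.2 (proof, p. 169)] -/
theorem parallelogram_trace {n : Type*} [Fintype n] (A B C : Matrix n n ℝ) :
    ((A - B) * (A - B)).trace + ((C - B) * (C - B)).trace - (1 / 2) * ((A - C) * (A - C)).trace =
      (1 / 2) * ((A - (2 : ℝ) • B + C) * (A - (2 : ℝ) • B + C)).trace := by
  have hAB := Matrix.trace_mul_comm A B
  have hAC := Matrix.trace_mul_comm A C
  have hBC := Matrix.trace_mul_comm B C
  simp only [Matrix.sub_mul, Matrix.mul_sub, Matrix.add_mul, Matrix.mul_add, Matrix.smul_mul,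
    Matrix.mul_smul, Matrix.trace_sub, Matrix.trace_add, Matrix.trace_smul, smul_eq_mul]
  linarith

/-- **The trace of the square of a symmetric matrix is the sum of the squares of its entries**,
hence nonnegative (Hamilton 1986, p. 169). [cite: Hamilton1986, §6, Lemma 6.2 (proof, p. 169)] -/
theorem trace_mul_self_nonneg_of_isSymm {n : Type*} [Fintype n] {S : Matrix n n ℝ}
    (h : S.IsSymm) : 0 ≤ (S * S).trace := by
  rw [Matrix.trace]
  refine Finset.sum_nonneg fun i _ ↦ ?_
  rw [Matrix.diag_apply, Matrix.mul_apply]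
  refine Finset.sum_nonneg fun j _ ↦ ?_
  rw [show S j i = S i j from h.apply i j]
  exact mul_self_nonneg _

/-! ### Trace inequalities for nonnegative symmetric matrices -/

/-- A symmetric real matrix with nonnegative quadratic form is a Gram matrix `ᵗN N`. [folklore] -/
theorem exists_transpose_mul_self_of_quad_nonneg {n : Type*} [Fintype n] [DecidableEq n]
    {Q : Matrix n n ℝ} (hQ : Q.IsSymm) (hQ0 : ∀ u : n → ℝ, 0 ≤ u ⬝ᵥ (Q *ᵥ u)) :
    ∃ N : Matrix n n ℝ, Q = Nᵀ * N := by
  refine exists_transpose_mul_self_of_posSemidef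
    (Matrix.PosSemidef.of_dotProduct_mulVec_nonneg ?_ fun u ↦ ?_)
  · change Qᴴ = Q
    rw [Matrix.conjTranspose_eq_transpose_of_trivial]
    exact hQ
  · rw [star_trivial]
    exact hQ0 u

/-- **`tr (XQ) ≥ 0` for symmetric `X ≥ 0` and symmetric `Q ≥ 0`** (write `Q = ᵗN N`; then
`tr (XQ) = Σₖ ᵗnₖ X nₖ` over the rows `nₖ` of `N`). [folklore] -/
theorem trace_mul_nonneg_of_nonneg {n : Type*} [Fintype n] [DecidableEq n] {X Q : Matrix n n ℝ}
    (hX0 : ∀ u : n → ℝ, 0 ≤ u ⬝ᵥ (X *ᵥ u)) (hQ : Q.IsSymm)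
    (hQ0 : ∀ u : n → ℝ, 0 ≤ u ⬝ᵥ (Q *ᵥ u)) : 0 ≤ (X * Q).trace := by
  obtain ⟨N, rfl⟩ := exists_transpose_mul_self_of_quad_nonneg hQ hQ0
  rw [← Matrix.mul_assoc, Matrix.trace_mul_comm, ← Matrix.mul_assoc]
  rw [Matrix.trace]
  refine Finset.sum_nonneg fun k _ ↦ ?_
  have e : (N * X * Nᵀ).diag k = (N k) ⬝ᵥ (X *ᵥ N k) := by
    simp only [Matrix.diag_apply, Matrix.mul_apply, Matrix.transpose_apply, dotProduct,
      Matrix.mulVec, Finset.sum_mul, Finset.mul_sum]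
    rw [Finset.sum_comm]
    refine Finset.sum_congr rfl fun i _ ↦ Finset.sum_congr rfl fun j _ ↦ ?_
    ring
  rw [e]
  exact hX0 _

/-- The trace of `Q ≥ 0` is nonnegative (`3 × 3`). [folklore] -/
theorem trace_nonneg_of_quad_nonneg {Q : Matrix (Fin 3) (Fin 3) ℝ}
    (hQ0 : ∀ u : Fin 3 → ℝ, 0 ≤ u ⬝ᵥ (Q *ᵥ u)) : 0 ≤ Q.trace := by
  have h := sum_quadratic_eq_trace_of_orthonormal Q (u := ![1, 0, 0]) (v := ![0, 1, 0])
    (w := ![0, 0, 1]) (by simp [dotProduct, Fin.sum_univ_three]) (by simp [dotProduct, Fin.sum_univ_three])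
    (by simp [dotProduct, Fin.sum_univ_three]) (by simp [dotProduct, Fin.sum_univ_three])
    (by simp [dotProduct, Fin.sum_univ_three]) (by simp [dotProduct, Fin.sum_univ_three])
  rw [← h]
  have := hQ0 ![1, 0, 0]; have := hQ0 ![0, 1, 0]; have := hQ0 ![0, 0, 1]
  positivity

/-- **The largest Rayleigh quotient is at most `tr P - 2p₁`** when `ᵗu P u ≥ p₁ |u|²` for all `u`
(complete a unit vector to an orthonormal basis: `tr P = Σ` of the three quadratic forms).
[folklore] -/
theorem quad_le_trace_sub_of_lower {P : Matrix (Fin 3) (Fin 3) ℝ} {p₁ : ℝ}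
    (hP : ∀ u : Fin 3 → ℝ, p₁ * (u ⬝ᵥ u) ≤ u ⬝ᵥ (P *ᵥ u)) {u : Fin 3 → ℝ} (hu : u ⬝ᵥ u = 1) :
    u ⬝ᵥ (P *ᵥ u) ≤ P.trace - 2 * p₁ := by
  obtain ⟨v, w, hv, hw, huv, huw, hvw⟩ := exists_orthonormal_complement hu
  have htr := sum_quadratic_eq_trace_of_orthonormal P hu hv hw huv huw hvw
  have h1 := hP v
  have h2 := hP w
  rw [hv, mul_one] at h1
  rw [hw, mul_one] at h2
  linarith

/-- The same bound for all vectors, by homogeneity: `ᵗu P u ≤ (tr P - 2p₁) |u|²`. [folklore] -/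
theorem quad_le_trace_sub_mul_of_lower {P : Matrix (Fin 3) (Fin 3) ℝ} {p₁ : ℝ}
    (hP : ∀ u : Fin 3 → ℝ, p₁ * (u ⬝ᵥ u) ≤ u ⬝ᵥ (P *ᵥ u)) (u : Fin 3 → ℝ) :
    u ⬝ᵥ (P *ᵥ u) ≤ (P.trace - 2 * p₁) * (u ⬝ᵥ u) := by
  have hu0 : 0 ≤ u ⬝ᵥ u := Finset.sum_nonneg fun i _ ↦ mul_self_nonneg _
  rcases hu0.eq_or_lt with h0 | hpos
  · have hu : u = 0 := dotProduct_self_eq_zero.1 h0.symm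
    simp [hu]
  · set r := u ⬝ᵥ u with hr
    set c : ℝ := (Real.sqrt r)⁻¹ with hc
    have hc2 : c ^ 2 * r = 1 := by
      rw [hc, inv_pow, Real.sq_sqrt hpos.le, inv_mul_cancel₀ hpos.ne']
    have hunit : (c • u) ⬝ᵥ (c • u) = 1 := by
      rw [smul_dotProduct, dotProduct_smul, smul_eq_mul, smul_eq_mul, ← mul_assoc, ← sq, ← hr, hc2]
    have h := quad_le_trace_sub_of_lower hP hunit
    rw [Matrix.mulVec_smul, dotProduct_smul, smul_dotProduct, smul_eq_mul, smul_eq_mul,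
      ← mul_assoc, ← sq] at h
    have hcpos : 0 < c ^ 2 := by positivity
    have e : u ⬝ᵥ (P *ᵥ u) = (c ^ 2 * (u ⬝ᵥ (P *ᵥ u))) * r := by
      rw [mul_comm (c ^ 2), mul_assoc, hc2, mul_one]
    rw [e]
    exact mul_le_mul_of_nonneg_right h hpos.le

/-- **Hamilton's trace inequality** (1986, p. 169: "If `P` and `Q` are two symmetric `3 × 3`
matrices with `P, Q ≥ 0`, and `p₁` is the smallest eigenvalue of `P` while `q` is the trace of
`Q`, then `tr P # Q ≥ p₁ q`"), variationally and in the normalisation `β = 2 #`: if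
`ᵗu P u ≥ p₁ |u|²` for all `u` and `Q` is symmetric with `ᵗu Q u ≥ 0` for all `u`, then
`tr β(P, Q) ≥ 2 p₁ tr Q`. Proof: `tr β(P, Q) - 2p₁ tr Q = tr (XQ)` with
`X = (tr P - 2p₁) · 1 - P ≥ 0` (`quad_le_trace_sub_mul_of_lower`), and `tr (XQ) ≥ 0`
(`trace_mul_nonneg_of_nonneg`). (No sign assumption on `p₁` is needed.)
[cite: Hamilton1986, §6, Lemma 6.2 (proof, p. 169)] -/
theorem trace_polarSharp_ge {P Q : Matrix (Fin 3) (Fin 3) ℝ} {p₁ : ℝ}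
    (hP : ∀ u : Fin 3 → ℝ, p₁ * (u ⬝ᵥ u) ≤ u ⬝ᵥ (P *ᵥ u)) (hQ : Q.IsSymm)
    (hQ0 : ∀ u : Fin 3 → ℝ, 0 ≤ u ⬝ᵥ (Q *ᵥ u)) :
    2 * p₁ * Q.trace ≤ (polarSharp P Q).trace := by
  set X : Matrix (Fin 3) (Fin 3) ℝ := (P.trace - 2 * p₁) • (1 : Matrix (Fin 3) (Fin 3) ℝ) - P
    with hX
  have hX0 : ∀ u : Fin 3 → ℝ, 0 ≤ u ⬝ᵥ (X *ᵥ u) := fun u ↦ by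
    rw [hX, Matrix.sub_mulVec, Matrix.smul_mulVec, Matrix.one_mulVec, dotProduct_sub,
      dotProduct_smul, smul_eq_mul]
    linarith [quad_le_trace_sub_mul_of_lower hP u]
  have h := trace_mul_nonneg_of_nonneg hX0 hQ hQ0
  rw [hX, Matrix.sub_mul, Matrix.smul_mul, Matrix.one_mul, Matrix.trace_sub, Matrix.trace_smul,
    smul_eq_mul] at h
  rw [trace_polarSharp]
  linarith

end HamiltonODE

end Literature.Geometry.Riemannian

end
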